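import Literature.Analysis.Convolution.ConvolutionPowerIntegerArithmetic
import Mathlib.Algebra.Polynomial.BigOperators
import HarnessLib

/-!
# Kronecker substitution with SIGNED coefficients: offset digits

Topic: `Literature/Analysis/Convolution`.  J. von zur Gathen, J. Gerhard, *Modern Computer Algebra* (3rd ed., CUP 2013),
§8.4: multiplying integer polynomials by evaluating at `x = 2^B` and reading the coefficients of the product off the
`2^B`-adic representation; for polynomials over `ℤ` (coefficients of either sign) one adds the constant
`Ω = Σ_m 2^{H} 2^{Bm}` so that every slot holds `c_m + 2^H ∈ [0, 2^B)` and the ordinary digits can be used.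
The tree's `kpack`/`kdigit` (`ConvolutionPowerIntegerArithmetic.lean`) treat natural digits; this file adds the signed
layer used by kernel certificates whose profile polynomials have coefficients of both signs:

* `kpackZ B M c = Σ_{j<M} c_j 2^{Bj} ∈ ℤ` and `eval_two_pow_eq_kpackZ` (`p(2^B) = kpackZ` of the coefficients of
  `p : ℤ[X]`, so products and powers of packs are packs of products and powers — `Polynomial.eval_mul/_pow`);
* `koffset B H M = Σ_{j<M} 2^H 2^{Bj}` and **`kdigit_kpackZ_add_koffset`**: if `−2^H ≤ c_j` and `c_j + 2^H < 2^B`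
  (`j < M`) then digit `m` of `kpackZ + Ω` is `c_m + 2^H`; polynomial form **`coeff_eq_kdigit_sub`**;
* the `ℓ¹` bookkeeping that certifies the digit bounds without computing coefficients: `l1norm`,
  `abs_coeff_le_l1norm`, `l1norm_mul_le`, `l1norm_pow_le`.

## References
* J. von zur Gathen, J. Gerhard, *Modern Computer Algebra*, 3rd ed., CUP 2013, §8.4. [GathenGerhard2013ModernComputerAlgebra]
-/

open Finset Polynomial
open scoped BigOperators

namespace Literature.Analysis.Convolution

/-! ### Signed packs and the offset -/

/-- **Signed Kronecker pack** of the slots `j < M` of `c : ℕ → ℤ` in base `2^B`: `Σ_{j<M} c_j 2^{Bj}`.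
[cite: GathenGerhard2013ModernComputerAlgebra, Section 8.4] -/
def kpackZ (B M : ℕ) (c : ℕ → ℤ) : ℤ := ∑ j ∈ range M, c j * 2 ^ (B * j)

/-- The digit offset `Ω = Σ_{j<M} 2^H · 2^{Bj}` (every slot shifted by `2^H`). [cite: GathenGerhard2013ModernComputerAlgebra, Section 8.4] -/
def koffset (B H M : ℕ) : ℕ := kpack B M (fun _ => 2 ^ H)

/-- `p(2^B)` is the signed pack of the coefficients of `p : ℤ[X]` (`deg p < M`).
[cite: GathenGerhard2013ModernComputerAlgebra, Section 8.4] -/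
theorem eval_two_pow_eq_kpackZ (p : ℤ[X]) {M : ℕ} (hM : p.natDegree < M) (B : ℕ) :
    p.eval ((2 : ℤ) ^ B) = kpackZ B M (fun j => p.coeff j) := by
  rw [Polynomial.eval_eq_sum_range' hM, kpackZ]
  refine Finset.sum_congr rfl fun j _ => ?_
  rw [pow_mul]

/-- The signed pack only sees the slots below `M`. [cite: GathenGerhard2013ModernComputerAlgebra, Section 8.4] -/
theorem kpackZ_congr {B M : ℕ} {c c' : ℕ → ℤ} (h : ∀ j < M, c j = c' j) : kpackZ B M c = kpackZ B M c' :=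
  Finset.sum_congr rfl fun j hj => by rw [h j (Finset.mem_range.1 hj)]

/-- **Adding the offset turns signed slots into natural digits**: if `−2^H ≤ c_j` for `j < M`,
`kpackZ B M c + Ω = kpack B M (j ↦ (c_j + 2^H).toNat)`. [cite: GathenGerhard2013ModernComputerAlgebra, Section 8.4] -/
theorem kpackZ_add_koffset {B H M : ℕ} {c : ℕ → ℤ} (hlo : ∀ j < M, -(2 : ℤ) ^ H ≤ c j) :
    kpackZ B M c + (koffset B H M : ℤ) = (kpack B M (fun j => (c j + 2 ^ H).toNat) : ℤ) := by
  unfold kpackZ koffset kpack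
  push_cast
  rw [← Finset.sum_add_distrib]
  refine Finset.sum_congr rfl fun j hj => ?_
  have h := hlo j (Finset.mem_range.1 hj)
  rw [Int.toNat_of_nonneg (by linarith)]
  ring

/-- **Reading a signed slot off the offset digits**: under `−2^H ≤ c_j` and `c_j + 2^H < 2^B` (`j < M`), the `m`-th
base-`2^B` digit of `(kpackZ B M c + Ω).toNat` is `c_m + 2^H` (`m < M`). [cite: GathenGerhard2013ModernComputerAlgebra, Section 8.4] -/
theorem kdigit_kpackZ_add_koffset {B H M : ℕ} {c : ℕ → ℤ} (hlo : ∀ j < M, -(2 : ℤ) ^ H ≤ c j)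
    (hhi : ∀ j < M, c j + 2 ^ H < 2 ^ B) {m : ℕ} (hm : m < M) :
    (kdigit B (kpackZ B M c + koffset B H M).toNat m : ℤ) = c m + 2 ^ H := by
  rw [kpackZ_add_koffset hlo, Int.toNat_natCast, kdigit_kpack _ m, if_pos hm,
    Int.toNat_of_nonneg (by linarith [hlo m hm])]
  intro j hj
  have h1 := hlo j hj
  have h2 := hhi j hj
  have h3 : (((c j + 2 ^ H).toNat : ℕ) : ℤ) < 2 ^ B := by
    rw [Int.toNat_of_nonneg (by linarith)]; exact h2
  exact_mod_cast h3

/-- **Polynomial form**: for `p : ℤ[X]` with `deg p < M` and `−2^H ≤ p_j`, `p_j + 2^H < 2^B` for all `j`, the coefficient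
`p_m` (`m < M`) is `digit_m((p(2^B) + Ω).toNat) − 2^H`. [cite: GathenGerhard2013ModernComputerAlgebra, Section 8.4] -/
theorem coeff_eq_kdigit_sub (p : ℤ[X]) {B H M : ℕ} (hM : p.natDegree < M)
    (hlo : ∀ j, -(2 : ℤ) ^ H ≤ p.coeff j) (hhi : ∀ j, p.coeff j + 2 ^ H < 2 ^ B) {m : ℕ} (hm : m < M) :
    p.coeff m = (kdigit B (p.eval ((2 : ℤ) ^ B) + koffset B H M).toNat m : ℤ) - 2 ^ H := by
  rw [eval_two_pow_eq_kpackZ p hM, kdigit_kpackZ_add_koffset (fun j _ => hlo j) (fun j _ => hhi j) hm]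
  ring

/-! ### `ℓ¹` bookkeeping for the digit bounds -/

/-- The `ℓ¹` norm of the coefficient vector of `p : ℤ[X]`. [cite: GathenGerhard2013ModernComputerAlgebra, Section 8.4] -/
def l1norm (p : ℤ[X]) : ℤ := ∑ i ∈ range (p.natDegree + 1), |p.coeff i|

/-- `ℓ¹` over any range containing the support. [cite: GathenGerhard2013ModernComputerAlgebra, Section 8.4] -/
theorem l1norm_eq_sum_range (p : ℤ[X]) {M : ℕ} (hM : p.natDegree < M) :
    l1norm p = ∑ i ∈ range M, |p.coeff i| := by
  rw [l1norm]
  obtain ⟨r, rfl⟩ : ∃ r, M = (p.natDegree + 1) + r := ⟨M - (p.natDegree + 1), by omega⟩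
  rw [Finset.sum_range_add (fun i => |p.coeff i|) (p.natDegree + 1) r,
    Finset.sum_eq_zero (s := range r) (fun i _ => by
      rw [Polynomial.coeff_eq_zero_of_natDegree_lt (by omega), abs_zero]), add_zero]

/-- `0 ≤ ‖p‖₁`. [cite: GathenGerhard2013ModernComputerAlgebra, Section 8.4] -/
theorem l1norm_nonneg (p : ℤ[X]) : 0 ≤ l1norm p := Finset.sum_nonneg fun _ _ => abs_nonneg _

/-- **Every coefficient is bounded by the `ℓ¹` norm.** [cite: GathenGerhard2013ModernComputerAlgebra, Section 8.4] -/
theorem abs_coeff_le_l1norm (p : ℤ[X]) (m : ℕ) : |p.coeff m| ≤ l1norm p := by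
  by_cases hm : m ≤ p.natDegree
  · rw [l1norm]
    exact Finset.single_le_sum (f := fun i => |p.coeff i|) (fun _ _ => abs_nonneg _)
      (Finset.mem_range.2 (Nat.lt_succ_of_le hm))
  · rw [Polynomial.coeff_eq_zero_of_natDegree_lt (not_le.1 hm), abs_zero]
    exact l1norm_nonneg p

/-- **Submultiplicativity** `‖p q‖₁ ≤ ‖p‖₁ ‖q‖₁`. [cite: GathenGerhard2013ModernComputerAlgebra, Section 8.4] -/
theorem l1norm_mul_le (p q : ℤ[X]) : l1norm (p * q) ≤ l1norm p * l1norm q := by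
  set Mp := p.natDegree + 1 with hMp
  set Mq := q.natDegree + 1 with hMq
  have hp : p.natDegree < Mp := by omega
  have hq : q.natDegree < Mq := by omega
  have hdeg : (p * q).natDegree < Mp + Mq := by
    have := Polynomial.natDegree_mul_le (p := p) (q := q); omega
  -- the coefficients of the product as a double sum
  have hcoeff : ∀ m, (p * q).coeff m =
      ∑ i ∈ range Mp, ∑ j ∈ range Mq, if i + j = m then p.coeff i * q.coeff j else 0 := by
    intro m
    conv_lhs => rw [Polynomial.as_sum_range' p Mp hp, Polynomial.as_sum_range' q Mq hq]
    rw [Finset.sum_mul_sum, Polynomial.finsetSum_coeff]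
    refine Finset.sum_congr rfl fun i _ => ?_
    rw [Polynomial.finsetSum_coeff]
    refine Finset.sum_congr rfl fun j _ => ?_
    rw [Polynomial.monomial_mul_monomial, Polynomial.coeff_monomial]
  rw [l1norm_eq_sum_range _ hdeg, l1norm, l1norm, Finset.sum_mul_sum]
  calc ∑ m ∈ range (Mp + Mq), |(p * q).coeff m|
      ≤ ∑ m ∈ range (Mp + Mq), ∑ i ∈ range Mp, ∑ j ∈ range Mq,
          (if i + j = m then |p.coeff i| * |q.coeff j| else 0) := by
        refine Finset.sum_le_sum fun m _ => ?_
        rw [hcoeff m]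
        refine (Finset.abs_sum_le_sum_abs _ _).trans (Finset.sum_le_sum fun i _ => ?_)
        refine (Finset.abs_sum_le_sum_abs _ _).trans (Finset.sum_le_sum fun j _ => ?_)
        split_ifs
        · rw [abs_mul]
        · rw [abs_zero]
    _ = ∑ i ∈ range Mp, ∑ j ∈ range Mq, ∑ m ∈ range (Mp + Mq),
          (if i + j = m then |p.coeff i| * |q.coeff j| else 0) := by
        rw [Finset.sum_comm]
        refine Finset.sum_congr rfl fun i _ => ?_
        rw [Finset.sum_comm]
    _ = ∑ i ∈ range Mp, ∑ j ∈ range Mq, |p.coeff i| * |q.coeff j| := by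
        refine Finset.sum_congr rfl fun i hi => Finset.sum_congr rfl fun j hj => ?_
        rw [Finset.sum_ite_eq, if_pos]
        exact Finset.mem_range.2 (by have := Finset.mem_range.1 hi; have := Finset.mem_range.1 hj; omega)

/-- `‖1‖₁ = 1`. [cite: GathenGerhard2013ModernComputerAlgebra, Section 8.4] -/
theorem l1norm_one : l1norm (1 : ℤ[X]) = 1 := by
  simp [l1norm]

/-- **Powers**: `‖p^n‖₁ ≤ ‖p‖₁^n`. [cite: GathenGerhard2013ModernComputerAlgebra, Section 8.4] -/
theorem l1norm_pow_le (p : ℤ[X]) (n : ℕ) : l1norm (p ^ n) ≤ l1norm p ^ n := by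
  induction n with
  | zero => rw [pow_zero, pow_zero, l1norm_one]
  | succ n ih =>
    rw [pow_succ, pow_succ]
    exact (l1norm_mul_le _ _).trans (mul_le_mul_of_nonneg_right ih (l1norm_nonneg p))

/-- **Digit bounds from an `ℓ¹` bound**: if `‖p‖₁ < 2^H` then `−2^H ≤ p_j` and `p_j + 2^H < 2^{H+1}` for every `j`, so
with `B = H + 1` the offset digits of `p(2^B) + Ω` are the coefficients. [cite: GathenGerhard2013ModernComputerAlgebra, Section 8.4] -/
theorem coeff_eq_kdigit_sub_of_l1norm_lt (p : ℤ[X]) {H M : ℕ} (hM : p.natDegree < M) (hp : l1norm p < 2 ^ H)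
    {m : ℕ} (hm : m < M) :
    p.coeff m = (kdigit (H + 1) (p.eval ((2 : ℤ) ^ (H + 1)) + koffset (H + 1) H M).toNat m : ℤ) - 2 ^ H := by
  have hb : ∀ j, |p.coeff j| < 2 ^ H := fun j => (abs_coeff_le_l1norm p j).trans_lt hp
  refine coeff_eq_kdigit_sub p hM (fun j => ?_) (fun j => ?_) hm
  · have := hb j; rw [abs_lt] at this; linarith [this.1]
  · have := hb j; rw [abs_lt] at this
    rw [pow_succ]; linarith [this.2]

end Literature.Analysis.Convolution
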